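import Summits.QuantumFields.YangMills.Theorems.BalabanLadderUVSeamRecCeilingsResponseCarriersInfluence
import Summits.QuantumFields.YangMills.Theorems.BalabanLadderUVSeamRecCeilingsPeriodClasses
import HarnessLib

/-!
# Crux `UVSeamRec` (stmt-QuantumFields-20043): the (β) press-button with the product law required ONLY on PERIOD-FREE
# subfamilies of the family shell — the typing caveat of record «ℤ⁴-indexed block-plaquettes vs torus periods» discharged

Helper file (`--supports stmt-QuantumFields-20043`) of the width-lever seat `ym-20043-ceilings-p2` (lane B, gen 3); sequel of
`…CeilingsResponseCarriersInfluence.lean` (p543486) and `…CeilingsPeriodClasses.lean` (this seat: period classes, the cyclic pigeonhole,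
the fold `exists_polymerSystem_of_periodFree`).  The conclusion of p543486 — (RM) verbatim with `B = A₀ + max(B_Q, 2e²W)` — holds when the
product law `⟨∏_{γ∈A} 1_{largeFieldEvent γ}∘lift⟩_{2L+1,β} ≤ ∏_{γ∈A} w γ` is required only for PERIOD-FREE `A ⊆ familyShell`
(the period-class map `γ ↦ (γ.k, anchor γ mod 2L+1, γ.μ, γ.ν)` is injective on `A`: no two members are `(2L+1)ℤ⁴`-translates), all other hypotheses and all constants unchanged
(`responseMoments_of_quadratic_and_influence_periodic`; registered-stub twin `responseMomentsOdd6_of_quadratic_and_influence_periodic`).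
So a torus-side supplier with level-periodic weights (`w γ = δ_{γ.k}`) has a satisfiable target; the law over ALL `A ⊆ familyShell` is not
satisfiable with small weights whenever two shells hold periodic translates (same lifted event).  HONEST FRAMING: bookkeeping for the OPEN
block-level product law of the (β) architecture of (RM) (its supplier is a Bałaban-type multiscale large-field estimate on odd tori, open);
(split) and (EM_Q) stay hypotheses; nothing of E0′; not a gap, not Clay.

References: H.-O. Georgii, *Gibbs Measures and Phase Transitions*, 2nd ed. (2011) Thm. 4.17 (DLR part, via p535725); T. Bałaban, Commun.
Math. Phys. 122 (1989) 355–392 (intended supplier).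
-/

set_option autoImplicit false

noncomputable section

open MeasureTheory Filter Topology Finset
open Literature.Probability.LatticeModels
open Literature.MathematicalPhysics.QuantumFieldTheory (GaugeConfig LatticeRep)
open Literature.MathematicalPhysics.QuantumLattice

namespace Summit.QuantumFields.YangMills.Cruxes.UVSeamRec.TemperedResponse

open Summit.QuantumFields.YangMills.Cruxes.OSLegsFromFemtoAndGap.DlrCollarTransfer
open Summit.QuantumFields.YangMills.Cruxes.UVSeamRec.PolymerData

/-! ## §4 The (β) press-button with the period-free product law -/

section Influence

variable {N : ℕ} [NeZero N]

/-- **(RM) from a quadratic carrier and tempered-d1's influence functional — PERIOD-FREE PRODUCT LAW.**  Exactly p543486's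
`responseMoments_of_quadratic_and_influence` (structure group `SU(N)`, any `r`, unit `a`; (split) for all exteriors against
`A₀ + Q + influenceAt 𝔟 ε kmax`; (EM_Q); per odd torus and cyclically separated family: weights `w γ ≥ 0` on the family shell with density
budget `Σ_γ familyCoeff i γ · w γ ≤ W`), EXCEPT that the product law `torusE(∏_{γ∈A} 1_{largeFieldEvent 𝔟 (ε β γ.k) γ}) ≤ ∏_{γ∈A} w γ` is asked
only of the PERIOD-FREE `A ⊆ familyShell` (the period-class map `γ ↦ (γ.k, anchor γ mod 2L+1, γ.μ, γ.ν)` injective on `A`).  THEN (RM) VERBATIM with the same `B = A₀ + max(B_Q, 2e²W)`.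
[folklore] -/
theorem responseMoments_of_quadratic_and_influence_periodic (r : LatticeRep (Matrix.specialUnitaryGroup (Fin N) ℂ))
    (a : ℝ → ℝ) (𝔟 : BlockSize) (ε : ℝ → ℕ → ℝ) (kmax : ℝ → ℕ → ℕ) {C₁ β₁ ℓ₁ A₀ B_Q W : ℝ}
    {p : Fin 4 × Fin 4 → ℝ → ℝ}
    (Q : ℝ → ℕ → Fin 4 × Fin 4 → (Fin 4 → ℤ) → LGConfig 4 (Matrix.specialUnitaryGroup (Fin N) ℂ) → ℝ)
    (MQ : ℝ → ℕ → Fin 4 × Fin 4 → (Fin 4 → ℤ) → ℝ)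
    (hQm : ∀ β R q x, Measurable (Q β R q x)) (hQb : ∀ β R q x η, |Q β R q x η| ≤ MQ β R q x)
    (hsplit : ∀ β : ℝ, β₁ ≤ β → ∀ R : ℕ, 1 ≤ R → (R : ℝ) * a β ≤ ℓ₁ →
      ∀ (q : Fin 4 × Fin 4) (x : Fin 4 → ℤ), q.1 < q.2 → ∀ η : LGConfig 4 (Matrix.specialUnitaryGroup (Fin N) ℂ),
        (R : ℝ) ^ 4 / C₁ * |kerE (Matrix.specialUnitaryGroup (Fin N) ℂ) r β (fun k => x k - (R + 1)) (2 * R + 3) η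
          (plane (Matrix.specialUnitaryGroup (Fin N) ℂ) r q x) - p q β| ≤
          A₀ + Q β R q x η + influenceAt (N := N) 𝔟 ε kmax β R q x η)
    (hEMQ : ∀ β : ℝ, β₁ ≤ β → ∀ (L n : ℕ) (q : Fin n → Fin 4 × Fin 4) (x : Fin n → (Fin 4 → ℤ)) (R : ℕ),
      (∀ i, (q i).1 < (q i).2) → 1 ≤ R → (R : ℝ) * a β ≤ ℓ₁ → 4 * R + 8 ≤ L →
      (∀ i j : Fin n, i ≠ j → ∃ k : Fin 4,
        (2 * (R : ℤ) + 4) ≤ |((((x i k - x j k : ℤ) : ZMod (2 * L + 1))).valMinAbs : ℤ)|) →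
      ∀ T : Finset (Fin n),
        torusE (Matrix.specialUnitaryGroup (Fin N) ℂ) r β L
          (fun U => Real.exp (((2 : ℕ) : ℝ) * ∑ i ∈ T, Q β R (q i) (x i) U)) ≤ Real.exp (B_Q * T.card))
    (hW : ∀ β : ℝ, β₁ ≤ β → ∀ (L n : ℕ) (q : Fin n → Fin 4 × Fin 4) (x : Fin n → (Fin 4 → ℤ)) (R : ℕ),
      (∀ i, (q i).1 < (q i).2) → 1 ≤ R → (R : ℝ) * a β ≤ ℓ₁ → 4 * R + 8 ≤ L →
      (∀ i j : Fin n, i ≠ j → ∃ k : Fin 4,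
        (2 * (R : ℤ) + 4) ≤ |((((x i k - x j k : ℤ) : ZMod (2 * L + 1))).valMinAbs : ℤ)|) →
      ∃ w : Polymer → ℝ, (∀ γ ∈ familyShell 𝔟 (kmax β R) R x, 0 ≤ w γ) ∧
        (∀ i, ∑ γ ∈ familyShell 𝔟 (kmax β R) R x, familyCoeff 𝔟 (kmax β R) R x i γ * w γ ≤ W) ∧
        (∀ A, A ⊆ familyShell 𝔟 (kmax β R) R x → Set.InjOn (fun γ : Polymer => (γ.k, Torus.proj (2 * L + 1) (anchor 𝔟 γ), γ.μ, γ.ν)) ↑A →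
          torusE (Matrix.specialUnitaryGroup (Fin N) ℂ) r β L (fun U => ∏ γ ∈ A,
            (largeFieldEvent (N := N) 𝔟 (ε β γ.k) γ).indicator (fun _ => (1 : ℝ)) U) ≤ ∏ γ ∈ A, w γ)) :
    ∀ β : ℝ, β₁ ≤ β → ∀ (L n : ℕ) (q : Fin n → Fin 4 × Fin 4) (x : Fin n → (Fin 4 → ℤ)) (R : ℕ),
      (∀ i, (q i).1 < (q i).2) → 1 ≤ R → (R : ℝ) * a β ≤ ℓ₁ → 4 * R + 8 ≤ L →
      (∀ i j : Fin n, i ≠ j → ∃ k : Fin 4,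
        (2 * (R : ℤ) + 4) ≤ |((((x i k - x j k : ℤ) : ZMod (2 * L + 1))).valMinAbs : ℤ)|) →
      ∀ T : Finset (Fin n),
        torusE (Matrix.specialUnitaryGroup (Fin N) ℂ) r β L (fun U => Real.exp (∑ i ∈ T, (R : ℝ) ^ 4 / C₁ *
          |kerE (Matrix.specialUnitaryGroup (Fin N) ℂ) r β (fun k => x i k - (R + 1)) (2 * R + 3) U
            (plane (Matrix.specialUnitaryGroup (Fin N) ℂ) r (q i) (x i)) - p (q i) β|)) ≤
          Real.exp ((A₀ + max B_Q (2 * Real.exp (2 * 1) * W)) * T.card) := by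
  refine responseMoments_of_quadratic_and_polymerLaw_local r a Q (influenceAt (N := N) 𝔟 ε kmax)
    (fun β R q x => max (MQ β R q x) (coeffMass 𝔟 (kmax β R) R x)) hQm
    (fun β R q x η => (hQb β R q x η).trans (le_max_left _ _))
    (fun β R q x => measurable_influenceAt (N := N) 𝔟 ε kmax β R q x)
    (fun β R q x η => (abs_influenceAt_le (N := N) 𝔟 ε kmax β R q x η).trans (le_max_right _ _)) hsplit hEMQ ?_
  intro β hβ L n q x R hq hR hRa hRL hsep
  obtain ⟨w, hw0, hwW, hpl⟩ := hW β hβ L n q x R hq hR hRa hRL hsep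
  obtain ⟨κ, S, E, w', c, hE, hw', hc, hdom, hΛ, hW', hpl'⟩ :=
    exists_polymerSystem_of_periodFree (N := N) r 𝔟 (ε β) (kmax β R) R L β x hRL hsep w hw0 hwW hpl
  exact ⟨κ, S, E, w', c, hE, hw', hc, fun i U => hdom i U, hΛ, hW', hpl'⟩

end Influence

/-! ## §5 At the registered stub (SU(2), fundamental representation, unit of record) -/

section Unit

/-- **The body of `stub_responseMomentsOdd6` from the (β) split with tempered-d1's influence functional and a PERIOD-FREE product
law.**  `SU(2)`, fundamental representation, a unit `a ≤ c·uRec` eventually: (split with `Q + influenceAt 𝔟 ε kmax`) + (EM_Q) + (weights,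
density budget `W` and product law for the `largeFieldEvent` gas on the PERIOD-FREE subfamilies of the family shell of every odd torus) ⇒ the
registered conclusion with `B = A₀ + max(B_Q, 2e²W)`.  A closer along (β) ends with
`exact responseMomentsOdd6_of_quadratic_and_influence_periodic …`. [folklore] -/
theorem responseMomentsOdd6_of_quadratic_and_influence_periodic {a : ℝ → ℝ} {c C₁ β₁ ℓ₁ A₀ B_Q W P₀ : ℝ}
    {p : Fin 4 × Fin 4 → ℝ → ℝ} (hc : 0 < c) (hle : ∀ᶠ β in atTop, a β ≤ c * Transport.uRec β) (hℓ₁ : 0 < ℓ₁)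
    (hC₁ : 0 < C₁) (hp : ∀ q β, |p q β| ≤ P₀) (𝔟 : BlockSize) (ε : ℝ → ℕ → ℝ) (kmax : ℝ → ℕ → ℕ)
    (Q : ℝ → ℕ → Fin 4 × Fin 4 → (Fin 4 → ℤ) → LGConfig 4 (Matrix.specialUnitaryGroup (Fin 2) ℂ) → ℝ)
    (MQ : ℝ → ℕ → Fin 4 × Fin 4 → (Fin 4 → ℤ) → ℝ)
    (hQm : ∀ β R q x, Measurable (Q β R q x)) (hQb : ∀ β R q x η, |Q β R q x η| ≤ MQ β R q x)
    (hsplit : ∀ β : ℝ, β₁ ≤ β → ∀ R : ℕ, 1 ≤ R → (R : ℝ) * a β ≤ ℓ₁ →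
      ∀ (q : Fin 4 × Fin 4) (x : Fin 4 → ℤ), q.1 < q.2 → ∀ η : LGConfig 4 (Matrix.specialUnitaryGroup (Fin 2) ℂ),
        (R : ℝ) ^ 4 / C₁ * |kerE (Matrix.specialUnitaryGroup (Fin 2) ℂ) (fundamentalLatticeRep 2) β (fun k => x k - (R + 1))
          (2 * R + 3) η (plane (Matrix.specialUnitaryGroup (Fin 2) ℂ) (fundamentalLatticeRep 2) q x) - p q β| ≤
          A₀ + Q β R q x η + influenceAt (N := 2) 𝔟 ε kmax β R q x η)
    (hEMQ : ∀ β : ℝ, β₁ ≤ β → ∀ (L n : ℕ) (q : Fin n → Fin 4 × Fin 4) (x : Fin n → (Fin 4 → ℤ)) (R : ℕ),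
      (∀ i, (q i).1 < (q i).2) → 1 ≤ R → (R : ℝ) * a β ≤ ℓ₁ → 4 * R + 8 ≤ L →
      (∀ i j : Fin n, i ≠ j → ∃ k : Fin 4,
        (2 * (R : ℤ) + 4) ≤ |((((x i k - x j k : ℤ) : ZMod (2 * L + 1))).valMinAbs : ℤ)|) →
      ∀ T : Finset (Fin n),
        torusE (Matrix.specialUnitaryGroup (Fin 2) ℂ) (fundamentalLatticeRep 2) β L
          (fun U => Real.exp (((2 : ℕ) : ℝ) * ∑ i ∈ T, Q β R (q i) (x i) U)) ≤ Real.exp (B_Q * T.card))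
    (hW : ∀ β : ℝ, β₁ ≤ β → ∀ (L n : ℕ) (q : Fin n → Fin 4 × Fin 4) (x : Fin n → (Fin 4 → ℤ)) (R : ℕ),
      (∀ i, (q i).1 < (q i).2) → 1 ≤ R → (R : ℝ) * a β ≤ ℓ₁ → 4 * R + 8 ≤ L →
      (∀ i j : Fin n, i ≠ j → ∃ k : Fin 4,
        (2 * (R : ℤ) + 4) ≤ |((((x i k - x j k : ℤ) : ZMod (2 * L + 1))).valMinAbs : ℤ)|) →
      ∃ w : Polymer → ℝ, (∀ γ ∈ familyShell 𝔟 (kmax β R) R x, 0 ≤ w γ) ∧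
        (∀ i, ∑ γ ∈ familyShell 𝔟 (kmax β R) R x, familyCoeff 𝔟 (kmax β R) R x i γ * w γ ≤ W) ∧
        (∀ A, A ⊆ familyShell 𝔟 (kmax β R) R x → Set.InjOn (fun γ : Polymer => (γ.k, Torus.proj (2 * L + 1) (anchor 𝔟 γ), γ.μ, γ.ν)) ↑A →
          torusE (Matrix.specialUnitaryGroup (Fin 2) ℂ) (fundamentalLatticeRep 2) β L (fun U => ∏ γ ∈ A,
            (largeFieldEvent (N := 2) 𝔟 (ε β γ.k) γ).indicator (fun _ => (1 : ℝ)) U) ≤ ∏ γ ∈ A, w γ)) :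
    ∃ (a : ℝ → ℝ) (c : ℝ) (C₁ B β₁ ℓ₁ P₀ : ℝ) (p : Fin 4 × Fin 4 → ℝ → ℝ), 0 < c ∧
      (∀ᶠ β in atTop, a β ≤ c * Transport.uRec β) ∧ 0 < ℓ₁ ∧ 0 < C₁ ∧ (∀ q β, |p q β| ≤ P₀) ∧
      ∀ β : ℝ, β₁ ≤ β → ∀ (L n : ℕ) (q : Fin n → Fin 4 × Fin 4) (x : Fin n → (Fin 4 → ℤ)) (R : ℕ),
        (∀ i, (q i).1 < (q i).2) → 1 ≤ R → (R : ℝ) * a β ≤ ℓ₁ → 4 * R + 8 ≤ L →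
        (∀ i j : Fin n, i ≠ j → ∃ k : Fin 4,
          (2 * (R : ℤ) + 4) ≤ |((((x i k - x j k : ℤ) : ZMod (2 * L + 1))).valMinAbs : ℤ)|) →
        ∀ T : Finset (Fin n),
          torusE (Matrix.specialUnitaryGroup (Fin 2) ℂ) (fundamentalLatticeRep 2) β L
            (fun U => Real.exp (∑ i ∈ T, (R : ℝ) ^ 4 / C₁ *
              |kerE (Matrix.specialUnitaryGroup (Fin 2) ℂ) (fundamentalLatticeRep 2) β (fun k => x i k - (R + 1)) (2 * R + 3) U
                (plane (Matrix.specialUnitaryGroup (Fin 2) ℂ) (fundamentalLatticeRep 2) (q i) (x i)) - p (q i) β|)) ≤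
            Real.exp (B * T.card) :=
  ⟨a, c, C₁, A₀ + max B_Q (2 * Real.exp (2 * 1) * W), β₁, ℓ₁, P₀, p, hc, hle, hℓ₁, hC₁, hp,
    responseMoments_of_quadratic_and_influence_periodic (N := 2) (fundamentalLatticeRep 2) a 𝔟 ε kmax Q MQ hQm hQb hsplit
      hEMQ hW⟩

end Unit

end Summit.QuantumFields.YangMills.Cruxes.UVSeamRec.TemperedResponse

end
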